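/-
Copyright (c) 2026 the pub-hodgecm-mathlib formalisation cell (harness21).  Prover seat hodgecm-mathlib-K2Liu-p08 (g3): Track B «K2-LIT»,
hLiu418 = stmt-HodgeConjecture-24832; LEAD F0P6-plan (g13) RULINGS «M-157o» (S5-W1) ∕ «M-157p» (4) ∕ 10:10:36Z (datum of record = LD2's standard doubled
line twisted section), file S5-W1-fin-b.
-/
import Literature.NumberTheory.GelbartRogawski1991.LocalDoubledTwistedSectionUnipotentWord   -- ★ (BR-N) exact one-parameter unipotent word
import Literature.NumberTheory.GelbartRogawski1991.LocalDoubledTwistedSectionWeylWord        -- ★ (BR-W) Weyl word, `exists_mover_weylWord`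
import HarnessLib

-- buildfix G11b-3 recipe (LEDGER B13-1/B13-3), as in the GelbartRogawski1991 siblings: elaborate sequentially.
set_option Elab.async false

/-!
# Crux `HLiu418`, road `K2_Liu`, #42S-S5 «incoherent pieces die», file S5-W1-fin-b:
# THE VALUE-AT-ZERO WORD of the local Siegel–Weil section of a LINE at `w_Δ · n(b·τ)` — an oscillatory integral in `b`

Cell `hodgecm-mathlib`, crux item hLiu418 = `stmt-HodgeConjecture-24832`; squad K2 ∕ K2Liu; prover K2Liu-p08 (g3).  THEOREMS ONLY (no `def`, no
instance, no notation, no named-fact hypothesis, no `sorry`); lane `--supports stmt-HodgeConjecture-24832 --as helper` (count-neutral helper).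

THE DATUM (LEAD F0P6-plan (g13) 10:10:36Z, of record for S5-W1-fin): the bad-place local Siegel–Weil datum of a hermitian LINE `⟨a⟩` is LD2's «standard
doubled line» twisted section `σ(h) = μ_v(det h)⁻¹ • ω^𝔻(s^𝔻(ι h))`, `ι = kronLoc L⁺ L c̄ v 2` (`G₁ = U(⟨1⟩ ⊕ ⟨−1⟩)(L⁺_v) → U(𝔻 ⊗ ⟨a⟩)`), acting on the
Schrödinger model `𝒮(L⁺_v^{2+2})` of the line in REAL coordinates (`T ∈ M_{1+1}(L⁺)` its binary trace form, `gramD L⁺ 2 T = T ⊕ −T`) — ★ (BR-N)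
`twistedSection_kronLoc_nElem_smul_apply_eq_conj_unipOpPi_smul` (the EXACT one-parameter word `σ(n(b·τ))Ψ = Γ⁻¹(unipOpPi (b • c_τ) (ΓΨ))`, scalar `1`)
and ★ (BR-W) `twistedSection_kronLoc_weylDelta_apply_eq_smul_conj_fourierOpPi_leviOpPi` (`σ(w₁)Ψ = γ • Γ⁻¹(𝓕(leviOpPi B′ (ΓΨ)))`).  The local SW section
read through the implementer `Γ` of the mover (`m₀ = (E″, Γ)` of ★ `swSectionLoc`) is `f_Ψ(h) = (Γ(σ(h)Ψ))(0)`.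

WHAT IS PROVED.
* §1 (abstract, any `ℂ`-module): the COMPOSITION of the two words, `Γ((σ_w ∘ σ_n)Ψ) = γ • 𝓕(A(U(ΓΨ)))` (`conj_word_comp`), and the value of a Fourier
  transform at `0`: `(𝓕 f)(0) = ∫ f dμ^{2+2}` (`coe_fourierOpPi_apply_zero`).
* §2 **`twistedSection_weylDelta_mul_nElem_smul_apply_zero`** — THE VALUE-AT-ZERO WORD: for every `b ∈ L⁺_v` and `Ψ`,
  **`(Γ(σ(w₁ · n(b·τ))Ψ))(0) = γ · ∫ x, (leviOpPi B′ (unipOpPi (b • c_τ) (ΓΨ)))(x) dμ^{2+2}`** with ONE `γ` (of the Weyl word) independent of `b`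
  (★ `twistedSection_mul` + (BR-N) + (BR-W)); by ★ `coe_leviOpPi_apply` ∕ ★ `coe_unipOpPi_apply` the integrand is
  `|det B′|^{−1∕2}·ψ_v(−b·halfForm c_τ (B′⁻¹x))·(ΓΨ)(B′⁻¹x)` — an oscillatory kernel in `b` of EXACTLY the shape of ★ S5-W1-fin-a
  `K2LiuOscillatoryBallLocalisation` (`θ_x(b) = ψ_v(b·(q(x) − β̃))` after the Whittaker twist `ψ_v(−b β̃)`), whence the ball-averaged local Whittaker value
  of the line's SW section DIES at a place where `q = halfForm c_τ ∘ B′⁻¹` does not take the value `β̃` (S5-W1 «`a_v` does not represent `h`»);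
  `exists_mover_valueAtZero_word` packages §2 over ★ `exists_mover_weylWord` (one mover `E″`, one `B′`, every implementer `Γ`).
HONEST LABEL.  `HC_CM` is proved only modulo the 7 printed citations (2 remaining named inputs: hLiu418 = `stmt-HodgeConjecture-24832`,
h413 = `stmt-HodgeConjecture-24833`) until rung 0 closes.

## References
* [Kudla1994] S. S. Kudla, *Splitting metaplectic covers of dual reductive pairs*, Israel J. Math. 87 (1994), §3 Thm. 3.1.
* [Rangarao1993] R. Ranga Rao, Pacific J. Math. 157 (1993), §3.1 (3.9), Lemma 3.2 (3.8) (Schrödinger-model operators of `n(c)`, `m(a)`, `w`).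
* [MoeglinVignerasWaldspurger1987] C. Mœglin, M.-F. Vignéras, J.-L. Waldspurger, LNM 1291 (1987), Chap. 2 II.1 (A)–(B), II.6.
* [KudlaRallis1994] S. Kudla, S. Rallis, Ann. of Math. 140 (1994), §2 (the Whittaker functional of `ω(·)Φ(0)`).
-/

set_option autoImplicit false
set_option linter.dupNamespace false -- the mandated namespace repeats `HodgeConjecture.HodgeConjecture`

noncomputable section

open scoped Matrix Kronecker
open NumberField IsDedekindDomain MeasureTheory MeasureTheory.Measure Matrix
open Literature.NumberTheory Literature.NumberTheory.Automorphic Literature.NumberTheory.Automorphic.UnitaryGroup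
open Literature.RepresentationTheory Literature.RepresentationTheory.HeisenbergGroup Literature.RepresentationTheory.TwistedCoinv
open Literature.RepresentationTheory.HeisenbergGroup.SymplecticMatrix
open Literature.NumberTheory.GelbartRogawski1991 Literature.NumberTheory.GelbartRogawski1991.UnitaryDualPair
open Literature.NumberTheory.GelbartRogawski1991.UnitaryDualPair.WeilCoinv
open Literature.NumberTheory.GelbartRogawski1991.UnitaryDualPair.LocalSplitting
open Literature.NumberTheory.Weil1964
open Literature.NumberTheory.GaloisRepresentations Literature.NumberTheory.GaloisRepresentations.IsNonarchimedeanLocalField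
open Literature.RepresentationTheory.HarrisKudlaSweet1996
open Literature.RepresentationTheory.MoeglinVignerasWaldspurger1987

namespace Summit.HodgeConjecture.HodgeConjecture.Cruxes.HLiu418.K2LiuRankOneLocalSWValueAtZeroWord

/-! ## §1 The composition of the two words (abstract) and the value of a Fourier transform at `0` -/

section Abstract

variable {S : Type*} [AddCommGroup S] [Module ℂ S]

/-- **`Γ((σ_w σ_n)Ψ) = γ • 𝓕(A(U(ΓΨ)))`** from the unipotent word `σ_n = Γ⁻¹ U Γ` and the Weyl word `σ_w = γ • Γ⁻¹ 𝓕 A Γ` (pure algebra in `End_ℂ S`).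
[cite: MoeglinVignerasWaldspurger1987, Chap. 2 II.1 (A)–(B)] -/
theorem conj_word_comp (σw σn : Module.End ℂ S) (Γ : S ≃ₗ[ℂ] S) (U A 𝓕 : S → S) (γ : ℂ)
    (hN : ∀ Ψ, σn Ψ = Γ.symm (U (Γ Ψ))) (hW : ∀ Ψ, σw Ψ = γ • Γ.symm (𝓕 (A (Γ Ψ)))) (Ψ : S) :
    Γ ((σw * σn) Ψ) = γ • 𝓕 (A (U (Γ Ψ))) := by
  rw [Module.End.mul_apply, hN, hW, LinearEquiv.apply_symm_apply, map_smul, LinearEquiv.apply_symm_apply]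

end Abstract

section Fourier

variable {F : Type} [Field F] [ValuativeRel F] [TopologicalSpace F] [IsNonarchimedeanLocalField F]
  [MeasurableSpace F] [BorelSpace F] (μ : Measure F) [μ.IsAddHaarMeasure] {ι : Type} [Fintype ι]
  {ψ : AddChar F Circle} (hψ : ψ.IsContinuousNontrivial) {m : ℤ} (hm : ψ.HasConductorExp m)

/-- **`(𝓕 f)(0) = ∫ f dμ^ι`** for the Schrödinger-model Fourier operator (★ `coe_fourierOpPi`, `piFourierSB` at `η = 0`: `ψ(x ⬝ᵥ 0) = 1`).
[cite: Rangarao1993, §3.1 (3.9), p. 349] -/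
theorem coe_fourierOpPi_apply_zero (f : SchwartzBruhat (ι → F)) :
    ((fourierOpPi μ hψ hm f : SchwartzBruhat (ι → F)) : (ι → F) → ℂ) 0 = ∫ x, (f : (ι → F) → ℂ) x ∂(Measure.pi fun _ : ι => μ) := by
  rw [coe_fourierOpPi, piFourierSB_apply]
  refine integral_congr_ae (Filter.Eventually.of_forall fun x => ?_)
  simp only [dotProduct_zero, AddChar.map_zero_eq_one, Circle.coe_one, one_mul]

end Fourier

/-! ## §2 The value-at-zero word of the standard doubled line's twisted section at `w₁ · n(b·τ)` -/

section CM

variable (L : Type) [Field L] [NumberField L] [IsCMField L] (v : HeightOneSpectrum (𝓞 (maximalRealSubfield L)))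
  [MeasurableSpace (v.adicCompletion (maximalRealSubfield L))] [BorelSpace (v.adicCompletion (maximalRealSubfield L))]
  (μ : Measure (v.adicCompletion (maximalRealSubfield L))) [μ.IsAddHaarMeasure]
  {T : Matrix (Fin (1 + 1)) (Fin (1 + 1)) (maximalRealSubfield L)} (hTs : T.IsSymm) (hTd : IsUnit T.det)
  (χ : HeckeCharacter L) (hχ : IsSplittingChar L 1 χ)
  {JD₁ : Matrix (Fin (1 + 1)) (Fin (1 + 1)) L}
  (hJD₁ : JD₁ = (gramD (maximalRealSubfield L) 1 1).map (algebraMap (maximalRealSubfield L) L))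
  (hTv : IsUnit (localGram (maximalRealSubfield L) (2 + 2) (gramD (maximalRealSubfield L) 2 T) v).det)

include hTd hTv in
set_option synthInstance.maxHeartbeats 400000 in
set_option maxHeartbeats 4000000 in -- the doubled CM datum's telescope (as ★ (BR-N), (BR-W), (OPW))
/-- **THE VALUE-AT-ZERO WORD.**  For a mover `E″` (`E″ ℓ_Δ = ℓ_Y`) with implementer `Γ`, `B′` with `E″ ι_D(w_Δ²) E″⁻¹ = J_𝕋⁻¹ m(B′)` (★ `exists_mover_weylWord`
provides such a pair for every `Γ`), a conductor exponent `m` of `ψ_v`, and a skew `τ ∈ L ⊗ L⁺_v`: there is ONE `γ ∈ ℂ` such that for ALL `b ∈ L⁺_v` and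
all `Ψ ∈ 𝒮(L⁺_v^{2+2})`,
  `(Γ(σ(w₁ · n(b·τ)) Ψ))(0) = γ · ∫ x, (leviOpPi B′ (unipOpPi (b • c_τ) (ΓΨ)))(x) dμ^{2+2}`,
`σ(h)Ψ = μ_v(det h)⁻¹ • ω^𝔻(s^𝔻(ι h))Ψ` the twisted section of the standard doubled line (★ `twistedSection_mul`, ★ (BR-N) exact one-parameter word, ★ (BR-W),
`(𝓕 f)(0) = ∫ f`).  The right side is an oscillatory integral in `b` with kernel `ψ_v(−b · halfForm c_τ(B′⁻¹x))` (★ `coe_leviOpPi_apply`,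
★ `coe_unipOpPi_apply`) — the input shape of ★ S5-W1-fin-a `K2LiuOscillatoryBallLocalisation`.
[cite: Kudla1994, §3 Thm. 3.1] [cite: Rangarao1993, §3.1 (3.9), Lemma 3.2 (3.8)] [cite: MoeglinVignerasWaldspurger1987, Chap. 2 II.1 (A)–(B), II.6] [cite: KudlaRallis1994, §2] -/
theorem exists_twistedSection_weylDelta_mul_nElem_smul_apply_zero
    (E'' : LocalSp (maximalRealSubfield L) (2 + 2) (gramD (maximalRealSubfield L) 2 T) v)
    (hE'' : (deltaLagrangian (maximalRealSubfield L) v 2).map (toLin (maximalRealSubfield L) v E'') =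
      lagrangianY (maximalRealSubfield L) (2 + 2) v)
    (Γ : SchwartzBruhat (Fin (2 + 2) → v.adicCompletion (maximalRealSubfield L)) ≃ₗ[ℂ] SchwartzBruhat (Fin (2 + 2) → v.adicCompletion (maximalRealSubfield L)))
    (hΓ : Implements (localSchrodinger (maximalRealSubfield L) (2 + 2) (gramD (maximalRealSubfield L) 2 T) v) (ofSymplectic _ E'') Γ)
    (B' : GL (Fin (2 + 2)) (v.adicCompletion (maximalRealSubfield L)))
    (hW : E'' * iotaD (maximalRealSubfield L) L (IsCMField.complexConj L) (complexConj_imagUnit L) (imagUnit_ne_zero L)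
        (imagUnit_mul_self L) v 2 hTs rfl (weylDelta (maximalRealSubfield L) L (IsCMField.complexConj L) v 2 (T₀ := T) rfl) * E''⁻¹ =
      (transportSp (localGram (maximalRealSubfield L) (2 + 2) (gramD (maximalRealSubfield L) 2 T) v) hTv (SymplecticGroup.symJ _ _))⁻¹ *
        transportSp (localGram (maximalRealSubfield L) (2 + 2) (gramD (maximalRealSubfield L) 2 T) v) hTv (levi B'))
    {m : ℤ} (hm : (adeleAddCharAt (maximalRealSubfield L) v).HasConductorExp m)
    (τ : LocalRing L v) (hτ : conjLocal L (IsCMField.complexConj L) v τ = -τ) :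
    ∃ γ : ℂ, ∀ (b : v.adicCompletion (maximalRealSubfield L)) (Ψ : SchwartzBruhat (Fin (2 + 2) → v.adicCompletion (maximalRealSubfield L))),
      ((Γ ((((localMu L χ v (Matrix.GeneralLinearGroup.det ((localPiEquiv L (IsCMField.complexConj L) (1 + 1) JD₁ v ((weylDelta (maximalRealSubfield L) L (IsCMField.complexConj L) v 1 hJD₁) * (nElem (maximalRealSubfield L) L (IsCMField.complexConj L) v 1 hJD₁ ((b • τ) • 1) (skew_smul_one (maximalRealSubfield L) L (IsCMField.complexConj L) v 1 (b • τ) (skew_smul L v b τ hτ))))).1)))⁻¹ : ℂˣ) : ℂ) •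
          MpPsi.toRep (localSchrodinger (maximalRealSubfield L) (2 + 2) (gramD (maximalRealSubfield L) 2 T) v)
            ((localSplittingDatumCM L v μ 2 hTs hTd rfl χ hχ).localSplitting ((kronLoc (maximalRealSubfield L) L (IsCMField.complexConj L) v 2 (T := T) (J := T.map (algebraMap (maximalRealSubfield L) L)) rfl rfl hJD₁) ((weylDelta (maximalRealSubfield L) L (IsCMField.complexConj L) v 1 hJD₁) * (nElem (maximalRealSubfield L) L (IsCMField.complexConj L) v 1 hJD₁ ((b • τ) • 1) (skew_smul_one (maximalRealSubfield L) L (IsCMField.complexConj L) v 1 (b • τ) (skew_smul L v b τ hτ)))))) Ψ) : SchwartzBruhat (Fin (2 + 2) → v.adicCompletion (maximalRealSubfield L))) : (Fin (2 + 2) → v.adicCompletion (maximalRealSubfield L)) → ℂ) 0 =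
        γ * ∫ x, ((leviOpPi (glEquiv B')
            (unipOpPi (isLocallyConstant_of_isContinuousNontrivial (isContinuousNontrivial_adeleAddCharAt (maximalRealSubfield L) v))
              (b • Matrix.mulVecLin (cOfFix (localGram (maximalRealSubfield L) (2 + 2) (gramD (maximalRealSubfield L) 2 T) v) (E'' * iotaD (maximalRealSubfield L) L (IsCMField.complexConj L) (complexConj_imagUnit L) (imagUnit_ne_zero L) (imagUnit_mul_self L) v 2 hTs rfl (nElem (maximalRealSubfield L) L (IsCMField.complexConj L) v 2 (T₀ := T) rfl (τ • 1) (skew_smul_one (maximalRealSubfield L) L (IsCMField.complexConj L) v 2 τ hτ)) * E''⁻¹))) (Γ Ψ)) : SchwartzBruhat (Fin (2 + 2) → v.adicCompletion (maximalRealSubfield L))) : (Fin (2 + 2) → v.adicCompletion (maximalRealSubfield L)) → ℂ) x ∂(Measure.pi fun _ : Fin (2 + 2) => μ) := by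
  obtain ⟨γ, hγ⟩ := twistedSection_kronLoc_weylDelta_apply_eq_smul_conj_fourierOpPi_leviOpPi L v μ hTs hTd χ hχ hJD₁ hTv E'' Γ hΓ B' hW hm
  refine ⟨γ, fun b Ψ => ?_⟩
  have h1 := congrArg (fun A : Module.End ℂ (SchwartzBruhat (Fin (2 + 2) → v.adicCompletion (maximalRealSubfield L))) => A Ψ)
    (twistedSection_mul L v μ χ hχ hTs hTd (kronLoc (maximalRealSubfield L) L (IsCMField.complexConj L) v 2 (T := T) (J := T.map (algebraMap (maximalRealSubfield L) L)) rfl rfl hJD₁)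
      (weylDelta (maximalRealSubfield L) L (IsCMField.complexConj L) v 1 hJD₁)
      (nElem (maximalRealSubfield L) L (IsCMField.complexConj L) v 1 hJD₁ ((b • τ) • 1) (skew_smul_one (maximalRealSubfield L) L (IsCMField.complexConj L) v 1 (b • τ) (skew_smul L v b τ hτ))))
  simp only [LinearMap.smul_apply, Module.End.mul_apply] at h1
  rw [h1, twistedSection_kronLoc_nElem_smul_apply_eq_conj_unipOpPi_smul L v μ hTs hTd χ hχ hJD₁ E'' hE'' Γ hΓ τ hτ b Ψ, hγ, map_smul,
    LinearEquiv.apply_symm_apply, LinearEquiv.apply_symm_apply, Submodule.coe_smul, Pi.smul_apply, smul_eq_mul, coe_fourierOpPi_apply_zero]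

include hTd hTv in
set_option synthInstance.maxHeartbeats 400000 in
set_option maxHeartbeats 4000000 in -- the doubled CM datum's telescope
/-- **THE VALUE-AT-ZERO WORD, MOVER-INSTANTIATED**: there are a mover `E″` (`E″ ℓ_Δ = ℓ_Y`, so `(E″, Γ)` is an admissible `m₀` of ★ `swSectionLoc` and the
hypothesis of ★ (BR-N)) and `B′` such that for EVERY implementer `Γ` of `E″` and every skew `τ` the value-at-zero word of
`exists_twistedSection_weylDelta_mul_nElem_smul_apply_zero` holds with some `γ` (★ `exists_mover_conj_iotaD_weylDelta`).
[cite: Kudla1994, §3 Thm. 3.1] [cite: Weil1964, n° 13 (16)] [cite: MoeglinVignerasWaldspurger1987, Chap. 2 II.1 (A)–(B), II.6] -/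
theorem exists_mover_valueAtZero_word {m : ℤ} (hm : (adeleAddCharAt (maximalRealSubfield L) v).HasConductorExp m) :
    ∃ (E'' : LocalSp (maximalRealSubfield L) (2 + 2) (gramD (maximalRealSubfield L) 2 T) v)
      (B' : GL (Fin (2 + 2)) (v.adicCompletion (maximalRealSubfield L))),
      (deltaLagrangian (maximalRealSubfield L) v 2).map (toLin (maximalRealSubfield L) v E'') =
        lagrangianY (maximalRealSubfield L) (2 + 2) v ∧
      ∀ (Γ : SchwartzBruhat (Fin (2 + 2) → v.adicCompletion (maximalRealSubfield L)) ≃ₗ[ℂ] SchwartzBruhat (Fin (2 + 2) → v.adicCompletion (maximalRealSubfield L))),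
        Implements (localSchrodinger (maximalRealSubfield L) (2 + 2) (gramD (maximalRealSubfield L) 2 T) v) (ofSymplectic _ E'') Γ →
        ∀ (τ : LocalRing L v) (hτ : conjLocal L (IsCMField.complexConj L) v τ = -τ),
        ∃ γ : ℂ, ∀ (b : v.adicCompletion (maximalRealSubfield L)) (Ψ : SchwartzBruhat (Fin (2 + 2) → v.adicCompletion (maximalRealSubfield L))),
      ((Γ ((((localMu L χ v (Matrix.GeneralLinearGroup.det ((localPiEquiv L (IsCMField.complexConj L) (1 + 1) JD₁ v ((weylDelta (maximalRealSubfield L) L (IsCMField.complexConj L) v 1 hJD₁) * (nElem (maximalRealSubfield L) L (IsCMField.complexConj L) v 1 hJD₁ ((b • τ) • 1) (skew_smul_one (maximalRealSubfield L) L (IsCMField.complexConj L) v 1 (b • τ) (skew_smul L v b τ hτ))))).1)))⁻¹ : ℂˣ) : ℂ) •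
          MpPsi.toRep (localSchrodinger (maximalRealSubfield L) (2 + 2) (gramD (maximalRealSubfield L) 2 T) v)
            ((localSplittingDatumCM L v μ 2 hTs hTd rfl χ hχ).localSplitting ((kronLoc (maximalRealSubfield L) L (IsCMField.complexConj L) v 2 (T := T) (J := T.map (algebraMap (maximalRealSubfield L) L)) rfl rfl hJD₁) ((weylDelta (maximalRealSubfield L) L (IsCMField.complexConj L) v 1 hJD₁) * (nElem (maximalRealSubfield L) L (IsCMField.complexConj L) v 1 hJD₁ ((b • τ) • 1) (skew_smul_one (maximalRealSubfield L) L (IsCMField.complexConj L) v 1 (b • τ) (skew_smul L v b τ hτ)))))) Ψ) : SchwartzBruhat (Fin (2 + 2) → v.adicCompletion (maximalRealSubfield L))) : (Fin (2 + 2) → v.adicCompletion (maximalRealSubfield L)) → ℂ) 0 =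
        γ * ∫ x, ((leviOpPi (glEquiv B')
            (unipOpPi (isLocallyConstant_of_isContinuousNontrivial (isContinuousNontrivial_adeleAddCharAt (maximalRealSubfield L) v))
              (b • Matrix.mulVecLin (cOfFix (localGram (maximalRealSubfield L) (2 + 2) (gramD (maximalRealSubfield L) 2 T) v) (E'' * iotaD (maximalRealSubfield L) L (IsCMField.complexConj L) (complexConj_imagUnit L) (imagUnit_ne_zero L) (imagUnit_mul_self L) v 2 hTs rfl (nElem (maximalRealSubfield L) L (IsCMField.complexConj L) v 2 (T₀ := T) rfl (τ • 1) (skew_smul_one (maximalRealSubfield L) L (IsCMField.complexConj L) v 2 τ hτ)) * E''⁻¹))) (Γ Ψ)) : SchwartzBruhat (Fin (2 + 2) → v.adicCompletion (maximalRealSubfield L))) : (Fin (2 + 2) → v.adicCompletion (maximalRealSubfield L)) → ℂ) x ∂(Measure.pi fun _ : Fin (2 + 2) => μ) := by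
  obtain ⟨E'', B', hE'', hW⟩ := exists_mover_conj_iotaD_weylDelta (maximalRealSubfield L) L (IsCMField.complexConj L)
    (complexConj_imagUnit L) (imagUnit_ne_zero L) (imagUnit_mul_self L) v 2 hTs hTd (rfl : (gramD (maximalRealSubfield L) 2 T).map
      (algebraMap (maximalRealSubfield L) L) = _) hTv
  exact ⟨E'', B', hE'', fun Γ hΓ τ hτ =>
    exists_twistedSection_weylDelta_mul_nElem_smul_apply_zero L v μ hTs hTd χ hχ hJD₁ hTv E'' hE'' Γ hΓ B' hW hm τ hτ⟩

end CM

end Summit.HodgeConjecture.HodgeConjecture.Cruxes.HLiu418.K2LiuRankOneLocalSWValueAtZeroWord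

end
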